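import Summits.BirchSwinnertonDyer.BirchSwinnertonDyer.Theses.UniversalToricDescent
import Literature.NumberTheory.EllipticCurves.IwasawaAlgebraRankOneIdealProofs
import Literature.NumberTheory.EllipticCurves.IwasawaAlgebraPseudoNullProofs
import HarnessLib

/-!
# Disproof of `TwinAlgMuZeroAtThree` (stmt-BirchSwinnertonDyer-24737) — findings

Standing disprover's work file (`cdisprove-stmt-BirchSwinnertonDyer-24737-g0`, refuter lineage,
cycle 1, 2026-08-29). Crux (route `UniversalToricDescent`, rank 205, R2 text; consumer = kernel⁺
24256 `…KernelRationalRoadOdd.kernelRat_of_r2Text`), VERBATIM over pinned decls — see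
`twinAlgMuZeroAtThree_iff` below for the readback through the abbreviation `Conclusion`:
for `E'/ℚ` (global minimal model `W'`), `N' = N_{E'}`, `K` imaginary quadratic Heegner for `N'` with
`d_K` odd, `ρ̄_{E',3}` onto, bucket guard `Mult E' 3 ∧ 3 ∤ ord₃ Δ_min ∨ GoodSS E' 3 ∧ a₃ = 0`, `κ`
anticyclotomic with topological generator `γ`, `𝔭 ∋ 3` of degree one, `𝔭' ∋ 3`, `𝔭' ≠ 𝔭`:
`X := XAc (E'/K) 3 κ 𝔭' ∅ γ` (print's `X_{∅,0}(E'/K_∞^{ac})`: relaxed at `𝔭`, strict at `𝔭' = 𝔭̄`) is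
`Λ`-torsion AND `Ch_Λ(X)·R₀⟦T⟧ = (g')` for some `g'` with a coefficient of `3`-adic norm `1` (`μ = 0`).
BSD is not proved by any of this.

## VERDICT (cycle 1): NO KILL — a located no-counterexample memo

* Lean level. The conclusion has exactly two definitional levers and both push TRUE: (i) the tree's
  `Module.charIdeal` is a `finprod` with junk value `⊤` off finitely-generated torsion modules, and
  `⊤·R₀⟦T⟧ = (1)` has the unit coefficient `1` (`exists_generator_of_eq_top`, §1); (ii) `X = 0`
  (more generally `X` finite = pseudo-null) satisfies BOTH conjuncts (`conclusion_of_subsingleton`,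
  §1). `XAc` itself is pinned to genuine cohomology (Pontryagin dual of Castella's `Sel_𝔭'(K_∞, E[3^∞])`,
  a `Λ`-module through `γ`), so no junk MODEL of `X` can be chosen; and at every rank-one UNIT datum
  (`ord_3 log P = 0`-type numerics) the conclusion is a tree THEOREM
  (`Theorems.UniversalToricDescentTwinAlgMuUnitPairs.twinAlgMu_at_mult_unit`, `…_at_goodSS_unit`,
  p728796: there `Ch_Λ(X)·R₀⟦T⟧ = R₀⟦T⟧`). A refutation therefore needs an EXPLICIT twin datum with
  `X` of positive `Λ`-rank or `μ_alg > 0` — an abstract Pontryagin dual, not computable in the kernel,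
  and (paper level) none is known or expected.
* Paper level. The load-bearing content is `Λ`-torsion ∧ `μ_alg(X_{∅,0}) = 0` at `p = 3` on bucket B
  (`3 ∥ N`, très ramifié) and bucket C₀ (`a₃ = 0`). Torsion: Howard/Castella–Hsieh/BCS Kolyvagin-system
  arguments need only `ρ̄` onto + Heegner + `p` split and are insensitive to the reduction type at `p`
  for the `(∅,0)` structure once a non-trivial BDP value exists; `μ = 0`: the printed engines
  ([BCS2024 = arXiv:2405.00270, Thm. 4.2.1 (b) p. 8, Prop. 4.2.2 p. 9] = Hsieh's `μ(𝓛^{BDP}) = 0`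
  [Hsieh2014 = arXiv:1112.1580, Thm. B pp. 3–4] + one divisibility) are stated for good ORDINARY `p`
  (and `(disc)` odd, p. 2); at `p = 3` multiplicative/supersingular they are NOT in print (presearch:
  corpus + galaxy, queries "anticyclotomic supersingular mu-invariant BDP", "relaxed strict Selmer
  multiplicative p=3": none) — OPEN, not false. The only printed SOURCE of anticyclotomic `μ > 0` is the
  Eisenstein/CM congruence mechanism (Vatsal; [Hsieh2014, p. 4 l. 40]), which needs `ρ̄₃` REDUCIBLE —
  excluded by `ρ̄₃` onto; for the `(∅,0)` structure `μ` is moreover isogeny-invariant (the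
  Perrin-Riou/Schneider isogeny defect `δ = Σ_{v∣p} (local) − (global)` vanishes for the relaxed/strict
  pair), and [CGLS = arXiv:2008.02571, pp. 2–3, 9, 12, 25] prove `μ = 0` even at Eisenstein `p` when
  `φ|_{G_p} ∉ {1, ω}`. So no `μ > 0` mechanism survives the hypotheses. Director's ruling applied:
  mutate hypotheses, not instances.

## LOAD-BEARING ANALYSIS (§2; "any proof must use H" ⟺ the mutant without H is false)

| hypothesis H | mutant (§2) | status |
|---|---|---|
| `SatisfiesHeegnerHypothesis N' K` | `…WithoutHeegner` | **LOAD-BEARING for the TORSION clause** (paper): in the DEFINITE case (an odd number of primes `q ∥ N'` inert in `K`; witness pattern `15a1`, `K = ℚ(√−23)`: `d_K = −23` odd, `3` split, `5` inert) the BDP-region central values `L(f, χ⁻¹, 0)` have sign `−1` and vanish identically ([Brooks2015IMRN, pp. 2 (ll. 24–26), 54 (ll. 16–18)]; BDP13 §4.1), the anticyclotomic restriction of the two-variable Greenberg-type `𝓛_𝔭` is `0`, and `X_{∅,0}` is expected (two-variable IMC divisibility + control) to have `Λ`-rank exactly `1` (`≤ 1` from `Sel_{ord,ord}` cotorsion,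 Bertolini–Darmon). Not kernel-checkable (needs that `Λ`-rank theorem and a `ModularParametrizationData` instance): near-miss `twinAlgMuZeroAtThree_false_without_heegner` (sorry, §3). |
| `W'.HasSurjectiveModNGaloisRep 3` | `…WithoutSurj` | the ENGINE hypothesis (Kolyvagin systems, big image). Dropping it admits CM twins (`32a2 = [0,0,0,−1,0]`, CM by `ℤ[i]`, `3` inert in `ℚ(i)` ⇒ `a₃ = 0`, bucket C₀; `K = ℚ(√−23)` is Heegner for `32`, odd, `3` split) and rational `3`-isogenies (Eisenstein `3`). NO counterexample known: `μ(X_{∅,0})` is isogeny-invariant and CGLS give `μ = 0` off `φ|_{G_3} ∈ {1, ω}`; the CM/`K ≠ F` supersingular case is simply open. Verdict: probably unnecessary for TRUTH, necessary for every known PROOF. |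
| bucket guard (vs R1's `¬ Addv E' 3`) | `…WithoutBucketGuard` (= stmt-24254 + `Odd d_K`) | NOT load-bearing for truth: the dropped bucket A (good ordinary `3`) is the case COVERED in print ([BCS2024, Prop. 4.2.2]); the guard is an engine restriction of the consumer. It IS a proper cut: `Negative/GuardCuts.lean` `not_bucketGuard_11a1` (`11a1`: `¬ Addv` but good ordinary, `a₃ = −1`). No `_false_without_`. SHARPENING for the planner: the engines use `3 ∤ ord₃ Δ_min` only through (H0) `E′(K_{∞,w})[3] = 0` at `w ∣ 3`; for split multiplicative `E′/ℚ₃` that is `⟺ 3 ∤ v₃(q) = v₃(Δ′)` (`μ₃ ⊄ ℚ₃`), but for NONSPLIT multiplicative reduction (H0) holds with NO condition on `v₃(Δ′)` (`#Ẽ_ns(𝔽_{3^m}) = 3^m + 1`, `Φ_w` of order ≤ 2, twisted `Ĝ_m` has no `3`-torsion, and `E′` stays nonsplit up the pro-3 tower) — bucket B could be widened to `Mult ∧ (nonsplit ∨ 3 ∤ v₃ Δ′)`; structurally the guard = «`ρ̄|_{G_3}` très ramifié» = Serre weight `p+1 = 4` (idea card `serre-weight-four-transport`). |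
| `Odd (NumberField.discr K)` | `…WithoutOddDisc` (= stmt-24254 + bucket guard) | NOT load-bearing for truth (BDP normalisation `(disc)` of [BCS2024, p. 2]; even `d_K` changes constants, not `μ`/torsion); proper cut: `Negative/GuardCuts.lean` `exists_heegner_split_not_odd` (`ℚ(√−14)`, `d_K = −56`, Heegner for `15`, `3` split). No `_false_without_`. |
| `𝔭' ≠ 𝔭` | `…Strong` (conclusion for EVERY `𝔭' ∋ 3`) | NOT load-bearing: `e(𝔭) = f(𝔭) = 1` already forces `3` split, and for `𝔭' = 𝔭` the module is `X_{0,∅} ≅ X_{∅,0}^ι` (complex conjugation), with the same torsion/`μ`. Information for the prover: `Strong` should follow from the crux by `ι`-transport (not typed here). |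
| `κ.IsAnticyclotomic` | — | not a lever (the only `ℤ₃`-extension in which `𝔭 ≠ 𝔭̄` play symmetric roles; for the cyclotomic `κ` the `(∅,0)` module is a different, Kato-type object — the statement would change meaning, not truth value in any checkable way). |
| binder `Dt'` | — | UNUSED (ground flag `ground.unused-binder`); any counterexample must still inhabit `ModularParametrizationData W' N'` (modularity; displayed fact `nonempty_modularParametrizationData`). |

## HABITATS / TIGHTNESS (landed on the Negative lane, `Theorems/TwinAlgMuZeroAtThree/Negative/`)

* `Habitat.lean` (p732095; re-landed without the route import p732976): `exists_two_primes_of_splitsIn`; `15a1` certificates (`Mult 3`,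
  `ord₃ Δ_min = 4`, `N = 15`, `ρ̄₃` onto via Frobenius witnesses `ℓ = 7, 37`); `exists_bucketB_antecedents`
  — ALL hypotheses except `Dt'` hold at `(15a1, K)` with `d_K = −11`; `…_with_parametrization` adds `Dt'`
  under `nonempty_modularParametrizationData`. The crux is NOT vacuous on bucket B.
* `HabitatC0.lean` (p733266): `17a1` (`a₃ = 0`, `N = 17`, `ρ̄₃` onto
  via `ℓ = 5, 19`) with `d_K = −35` (Heegner for `51`): `exists_bucketC0_antecedents`. Not vacuous on C₀.
* `GuardCuts.lean` (p732219; re-landed without the route import p733051): `not_bucketGuard_11a1`, `exists_heegner_split_not_odd` — R2 ⊊ R1 on the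
  curve side and on the field side.

## -- Targets
None this cycle (no line picked; payload `targets = []`).

## HANDOFF
* Landed: `Negative/Habitat.lean` (p732095 → p732976 ACCEPTED), `Negative/GuardCuts.lean` (p732219 → p733051 ACCEPTED),
  `Negative/HabitatC0.lean` (p733266, submitted). Idea card filed: `Ideas/serre-weight-four-transport.md` (disprover's
  standing-cover idea: residual BDP Selmer module level-at-3 blind under (H0); source = weight-4 level-`N′/3` ordinary
  congruent form, e.g. `5.4.a.a ≡ 15a1 (mod 3)` verified at `ℓ ≤ 47`; Hsieh Thm 2 has no weight bound, p.4 L13–37).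
* Sorried here (near-miss, §3): `twinAlgMuZeroAtThree_false_without_heegner` — obstruction: no tree
  theorem gives `Λ`-rank ≥ 1 of `X_{∅,0}` in the definite case (needs the two-variable divisibility
  `Ch ∣ 𝓛_𝔭` from Beilinson–Flach classes + sign `−1` vanishing + anticyclotomic control), and
  `ModularParametrizationData 15a1 15` has no constructor in the tree.
* Next regimes if re-armed: (1) type the `ι`-transport `X_{0,∅} ≅ X_{∅,0}^ι` and upgrade the `Strong`
  row to a theorem; (2) if a line is picked, attack its stubs' hypotheses on the two habitats (every stub
  must be consistent with `15a1/ℚ(√−11)` and `17a1/ℚ(√−35)`, and with the unit-pair theorems p728796);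
  (3) watch for a definite-case `Λ`-rank theorem entering `Literature/` (then close §3's sorry as a
  Negative lemma `…_false_without_heegner`).
-/

noncomputable section

open scoped Classical

-- D-0017: single-problem summit, so `Summit.BirchSwinnertonDyer.BirchSwinnertonDyer.…` repeats a
-- namespace BY DESIGN.
set_option linter.dupNamespace false

namespace Summit.BirchSwinnertonDyer.BirchSwinnertonDyer.Cruxes.TwinAlgMuZeroAtThree.Disproof

open WeierstrassCurve NumberField IsDedekindDomain Field
open Literature.NumberTheory.EllipticCurves Literature.NumberTheory.EllipticCurves.Rank1Residual
open Literature.NumberTheory.EllipticCurves.ModularForms (ModularParametrizationData)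
open Summit.BirchSwinnertonDyer.Rank1Residual.X11b
open Summit.BirchSwinnertonDyer.Rank1Residual.X11b.AcSelmer
open Summit.BirchSwinnertonDyer.Rank1Residual.X11b.Halves
open Summit.BirchSwinnertonDyer.BirchSwinnertonDyer.Theses.UniversalToricDescent (TwinAlgMuZeroAtThree)

/-! ## §1 The conclusion, its readback, and its two definitional levers (both push TRUE) -/

/-- The CONCLUSION of the crux at a datum `(E'/K, κ, γ, 𝔭')`: `X = XAc (E'/K) 3 κ 𝔭' ∅ γ` is
`Λ`-torsion and `Ch_Λ(X)·R₀⟦T⟧ = (g')` for a `g'` with a coefficient of `3`-adic norm `1`. [folklore] -/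
def Conclusion {K : Type} [Field K] [NumberField K] (W' : WeierstrassCurve ℚ) (κ : ZpExtension K 3)
    (γ : absoluteGaloisGroup K) [Fact (κ.IsTopGenerator γ)] (𝔭' : HeightOneSpectrum (𝓞 K)) : Prop :=
  Module.IsTorsion (IwasawaAlgebra 3) (XAc (W'.baseChange K) 3 κ 𝔭' ∅ γ) ∧
    ∃ g' : UnrSeries 3,
      (XAc.charIdeal (W'.baseChange K) 3 κ 𝔭' ∅ γ).map (PowerSeries.map (toUnr 3)) = Ideal.span {g'} ∧
        ∃ i : ℕ, ‖((PowerSeries.coeff i g' : unrIntegers 3) : ℂ_[3])‖ = 1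

/-- READBACK: the crux is, symbol for symbol, "hypotheses ⇒ `Conclusion W' κ γ 𝔭'`". [folklore] -/
theorem twinAlgMuZeroAtThree_iff :
    TwinAlgMuZeroAtThree ↔
      ∀ (W' : WeierstrassCurve ℚ) [W'.IsElliptic] [W'.IsGloballyMinimal] (N' : ℕ) [NeZero N']
        (K : Type) [Field K] [NumberField K] (_Dt' : ModularParametrizationData W' N'),
        (Mult W' 3 ∧ ¬ 3 ∣ padicValInt 3 W'.minimalDiscriminantInt ∨
            GoodSS W' 3 ∧ W'.frobeniusTrace 3 = 0) →
          W'.HasSurjectiveModNGaloisRep 3 → W'.conductorNorm ℤ = N' → IsImaginaryQuadratic K →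
            SatisfiesHeegnerHypothesis N' K → Odd (NumberField.discr K) →
              ∀ (κ : ZpExtension K 3), κ.IsAnticyclotomic →
                ∀ (γ : absoluteGaloisGroup K) [Fact (κ.IsTopGenerator γ)]
                  (𝔭 : HeightOneSpectrum (𝓞 K)), ((3 : ℕ) : 𝓞 K) ∈ 𝔭.asIdeal →
                    𝔭.asIdeal.ramificationIdx (𝓞 ℚ) = 1 → 𝔭.asIdeal.inertiaDeg (𝓞 ℚ) = 1 →
                      ∀ (𝔭' : HeightOneSpectrum (𝓞 K)), ((3 : ℕ) : 𝓞 K) ∈ 𝔭'.asIdeal → 𝔭' ≠ 𝔭 →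
                        Conclusion W' κ γ 𝔭' :=
  Iff.rfl

/-- LEVER (i): an ideal that is (junk-)`⊤` maps to `(1)` in `R₀⟦T⟧`, and `1` has the unit coefficient
`1`: the second conjunct of `Conclusion` is AUTOMATIC whenever `Ch_Λ(X) = ⊤` (in particular at the
`finprod` junk value of a non-torsion or non-finitely-generated `X`). [folklore] -/
theorem exists_generator_of_eq_top {I : Ideal (IwasawaAlgebra 3)} (hI : I = ⊤) :
    ∃ g' : UnrSeries 3, I.map (PowerSeries.map (toUnr 3)) = Ideal.span {g'} ∧
      ∃ i : ℕ, ‖((PowerSeries.coeff i g' : unrIntegers 3) : ℂ_[3])‖ = 1 :=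
  ⟨1, by rw [hI, Ideal.map_top, Ideal.span_singleton_one], 0, by simp⟩

/-- LEVER (ii): a FINITE `X` (pseudo-null over `Λ = ℤ₃⟦T⟧`; e.g. `X = 0`) satisfies the whole
`Conclusion`: it is torsion (a finite module over the infinite domain `Λ` has non-zero annihilators)
and `Ch_Λ(X) = ⊤` (tree `Module.charIdeal_eq_top_of_isPseudoNull`, `isPseudoNull_of_finite`). So the
crux cannot be refuted at a datum where `X_{∅,0}` is finite — the generic rank-one unit situation of
p728796. [folklore] -/
theorem conclusion_of_finite {K : Type} [Field K] [NumberField K] (W' : WeierstrassCurve ℚ)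
    (κ : ZpExtension K 3) (γ : absoluteGaloisGroup K) [Fact (κ.IsTopGenerator γ)]
    (𝔭' : HeightOneSpectrum (𝓞 K)) [Finite (XAc (W'.baseChange K) 3 κ 𝔭' ∅ γ)] :
    Conclusion W' κ γ 𝔭' := by
  have hpn := isPseudoNull_of_finite 3 (XAc (W'.baseChange K) 3 κ 𝔭' ∅ γ)
  refine ⟨fun x ↦ ?_, exists_generator_of_eq_top (Module.charIdeal_eq_top_of_isPseudoNull hpn)⟩
  -- every element of a pseudo-null `Λ`-module is killed by a power of `p` (tree), and `C 3 ≠ 0`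
  obtain ⟨n, hn⟩ := exists_C_p_pow_smul_eq_zero_of_isPseudoNull 3 hpn x
  have hC : (PowerSeries.C (3 : ℤ_[3]) : IwasawaAlgebra 3) ≠ 0 := fun h ↦ by
    simpa using congrArg (PowerSeries.coeff 0) h
  exact ⟨⟨_, mem_nonZeroDivisors_of_ne_zero (pow_ne_zero n hC)⟩, hn⟩

/-! ## §2 Mutants (one hypothesis dropped / weakened each) and their trivial comparison maps -/

/-- MUTANT: the crux WITHOUT `SatisfiesHeegnerHypothesis N' K` (the definite case enters).
[folklore] -/
def TwinAlgMuZeroAtThreeWithoutHeegner : Prop :=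
  ∀ (W' : WeierstrassCurve ℚ) [W'.IsElliptic] [W'.IsGloballyMinimal] (N' : ℕ) [NeZero N']
    (K : Type) [Field K] [NumberField K] (_Dt' : ModularParametrizationData W' N'),
    (Mult W' 3 ∧ ¬ 3 ∣ padicValInt 3 W'.minimalDiscriminantInt ∨
        GoodSS W' 3 ∧ W'.frobeniusTrace 3 = 0) →
      W'.HasSurjectiveModNGaloisRep 3 → W'.conductorNorm ℤ = N' → IsImaginaryQuadratic K →
        Odd (NumberField.discr K) →
          ∀ (κ : ZpExtension K 3), κ.IsAnticyclotomic →
            ∀ (γ : absoluteGaloisGroup K) [Fact (κ.IsTopGenerator γ)]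
              (𝔭 : HeightOneSpectrum (𝓞 K)), ((3 : ℕ) : 𝓞 K) ∈ 𝔭.asIdeal →
                𝔭.asIdeal.ramificationIdx (𝓞 ℚ) = 1 → 𝔭.asIdeal.inertiaDeg (𝓞 ℚ) = 1 →
                  ∀ (𝔭' : HeightOneSpectrum (𝓞 K)), ((3 : ℕ) : 𝓞 K) ∈ 𝔭'.asIdeal → 𝔭' ≠ 𝔭 →
                    Conclusion W' κ γ 𝔭'

/-- MUTANT: the crux WITHOUT `ρ̄_{E',3}` onto (CM twins and rational `3`-isogenies enter). [folklore] -/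
def TwinAlgMuZeroAtThreeWithoutSurj : Prop :=
  ∀ (W' : WeierstrassCurve ℚ) [W'.IsElliptic] [W'.IsGloballyMinimal] (N' : ℕ) [NeZero N']
    (K : Type) [Field K] [NumberField K] (_Dt' : ModularParametrizationData W' N'),
    (Mult W' 3 ∧ ¬ 3 ∣ padicValInt 3 W'.minimalDiscriminantInt ∨
        GoodSS W' 3 ∧ W'.frobeniusTrace 3 = 0) →
      W'.conductorNorm ℤ = N' → IsImaginaryQuadratic K →
        SatisfiesHeegnerHypothesis N' K → Odd (NumberField.discr K) →
          ∀ (κ : ZpExtension K 3), κ.IsAnticyclotomic →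
            ∀ (γ : absoluteGaloisGroup K) [Fact (κ.IsTopGenerator γ)]
              (𝔭 : HeightOneSpectrum (𝓞 K)), ((3 : ℕ) : 𝓞 K) ∈ 𝔭.asIdeal →
                𝔭.asIdeal.ramificationIdx (𝓞 ℚ) = 1 → 𝔭.asIdeal.inertiaDeg (𝓞 ℚ) = 1 →
                  ∀ (𝔭' : HeightOneSpectrum (𝓞 K)), ((3 : ℕ) : 𝓞 K) ∈ 𝔭'.asIdeal → 𝔭' ≠ 𝔭 →
                    Conclusion W' κ γ 𝔭'

/-- MUTANT: the crux with R1's guard `¬ Addv E' 3` in place of the bucket guard (bucket A = good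
ordinary `3` re-enters): stmt-24254 + `Odd d_K`. [folklore] -/
def TwinAlgMuZeroAtThreeWithoutBucketGuard : Prop :=
  ∀ (W' : WeierstrassCurve ℚ) [W'.IsElliptic] [W'.IsGloballyMinimal] (N' : ℕ) [NeZero N']
    (K : Type) [Field K] [NumberField K] (_Dt' : ModularParametrizationData W' N'),
    ¬ Addv W' 3 →
      W'.HasSurjectiveModNGaloisRep 3 → W'.conductorNorm ℤ = N' → IsImaginaryQuadratic K →
        SatisfiesHeegnerHypothesis N' K → Odd (NumberField.discr K) →
          ∀ (κ : ZpExtension K 3), κ.IsAnticyclotomic →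
            ∀ (γ : absoluteGaloisGroup K) [Fact (κ.IsTopGenerator γ)]
              (𝔭 : HeightOneSpectrum (𝓞 K)), ((3 : ℕ) : 𝓞 K) ∈ 𝔭.asIdeal →
                𝔭.asIdeal.ramificationIdx (𝓞 ℚ) = 1 → 𝔭.asIdeal.inertiaDeg (𝓞 ℚ) = 1 →
                  ∀ (𝔭' : HeightOneSpectrum (𝓞 K)), ((3 : ℕ) : 𝓞 K) ∈ 𝔭'.asIdeal → 𝔭' ≠ 𝔭 →
                    Conclusion W' κ γ 𝔭'

/-- MUTANT: the crux WITHOUT `Odd d_K` (= stmt-24254 restricted by the bucket guard). [folklore] -/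
def TwinAlgMuZeroAtThreeWithoutOddDisc : Prop :=
  ∀ (W' : WeierstrassCurve ℚ) [W'.IsElliptic] [W'.IsGloballyMinimal] (N' : ℕ) [NeZero N']
    (K : Type) [Field K] [NumberField K] (_Dt' : ModularParametrizationData W' N'),
    (Mult W' 3 ∧ ¬ 3 ∣ padicValInt 3 W'.minimalDiscriminantInt ∨
        GoodSS W' 3 ∧ W'.frobeniusTrace 3 = 0) →
      W'.HasSurjectiveModNGaloisRep 3 → W'.conductorNorm ℤ = N' → IsImaginaryQuadratic K →
        SatisfiesHeegnerHypothesis N' K →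
          ∀ (κ : ZpExtension K 3), κ.IsAnticyclotomic →
            ∀ (γ : absoluteGaloisGroup K) [Fact (κ.IsTopGenerator γ)]
              (𝔭 : HeightOneSpectrum (𝓞 K)), ((3 : ℕ) : 𝓞 K) ∈ 𝔭.asIdeal →
                𝔭.asIdeal.ramificationIdx (𝓞 ℚ) = 1 → 𝔭.asIdeal.inertiaDeg (𝓞 ℚ) = 1 →
                  ∀ (𝔭' : HeightOneSpectrum (𝓞 K)), ((3 : ℕ) : 𝓞 K) ∈ 𝔭'.asIdeal → 𝔭' ≠ 𝔭 →
                    Conclusion W' κ γ 𝔭'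

/-- STRENGTHENING: the crux WITHOUT `𝔭' ≠ 𝔭` — the conclusion for EVERY prime `𝔭' ∋ 3`, including
the strict-at-`𝔭` module `X_{0,∅}`. [folklore] -/
def TwinAlgMuZeroAtThreeStrong : Prop :=
  ∀ (W' : WeierstrassCurve ℚ) [W'.IsElliptic] [W'.IsGloballyMinimal] (N' : ℕ) [NeZero N']
    (K : Type) [Field K] [NumberField K] (_Dt' : ModularParametrizationData W' N'),
    (Mult W' 3 ∧ ¬ 3 ∣ padicValInt 3 W'.minimalDiscriminantInt ∨
        GoodSS W' 3 ∧ W'.frobeniusTrace 3 = 0) →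
      W'.HasSurjectiveModNGaloisRep 3 → W'.conductorNorm ℤ = N' → IsImaginaryQuadratic K →
        SatisfiesHeegnerHypothesis N' K → Odd (NumberField.discr K) →
          ∀ (κ : ZpExtension K 3), κ.IsAnticyclotomic →
            ∀ (γ : absoluteGaloisGroup K) [Fact (κ.IsTopGenerator γ)]
              (𝔭 : HeightOneSpectrum (𝓞 K)), ((3 : ℕ) : 𝓞 K) ∈ 𝔭.asIdeal →
                𝔭.asIdeal.ramificationIdx (𝓞 ℚ) = 1 → 𝔭.asIdeal.inertiaDeg (𝓞 ℚ) = 1 →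
                  ∀ (𝔭' : HeightOneSpectrum (𝓞 K)), ((3 : ℕ) : 𝓞 K) ∈ 𝔭'.asIdeal →
                    Conclusion W' κ γ 𝔭'

/-- Each mutant IMPLIES the crux (it has fewer hypotheses): certificates that §2's statements are
genuine weakenings of the hypothesis side / strengthenings of the statement. [folklore] -/
theorem twinAlgMuZeroAtThree_of_withoutHeegner (h : TwinAlgMuZeroAtThreeWithoutHeegner) :
    TwinAlgMuZeroAtThree :=
  fun W' _ _ N' _ K _ _ Dt' hb hs hN hK _ ho κ hκ γ _ 𝔭 h𝔭 he hf 𝔭' h𝔭' hne ↦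
    h W' N' K Dt' hb hs hN hK ho κ hκ γ 𝔭 h𝔭 he hf 𝔭' h𝔭' hne

/-- See `twinAlgMuZeroAtThree_of_withoutHeegner`. [folklore] -/
theorem twinAlgMuZeroAtThree_of_withoutSurj (h : TwinAlgMuZeroAtThreeWithoutSurj) :
    TwinAlgMuZeroAtThree :=
  fun W' _ _ N' _ K _ _ Dt' hb _ hN hK hH ho κ hκ γ _ 𝔭 h𝔭 he hf 𝔭' h𝔭' hne ↦
    h W' N' K Dt' hb hN hK hH ho κ hκ γ 𝔭 h𝔭 he hf 𝔭' h𝔭' hne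

/-- The bucket guard implies R1's `¬ Addv E' 3` (multiplicative or good is not additive), so the
R1-guard mutant implies the crux. [folklore] -/
theorem twinAlgMuZeroAtThree_of_withoutBucketGuard (h : TwinAlgMuZeroAtThreeWithoutBucketGuard) :
    TwinAlgMuZeroAtThree := by
  intro W' _ _ N' _ K _ _ Dt' hb hs hN hK hH ho κ hκ γ _ 𝔭 h𝔭 he hf 𝔭' h𝔭' hne
  refine h W' N' K Dt' ?_ hs hN hK hH ho κ hκ γ 𝔭 h𝔭 he hf 𝔭' h𝔭' hne
  rintro ⟨hng, hnm⟩
  rcases hb with ⟨hm, -⟩ | ⟨⟨hg, -⟩, -⟩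
  · exact hnm hm
  · exact hng hg

/-- See `twinAlgMuZeroAtThree_of_withoutHeegner`. [folklore] -/
theorem twinAlgMuZeroAtThree_of_withoutOddDisc (h : TwinAlgMuZeroAtThreeWithoutOddDisc) :
    TwinAlgMuZeroAtThree :=
  fun W' _ _ N' _ K _ _ Dt' hb hs hN hK hH _ κ hκ γ _ 𝔭 h𝔭 he hf 𝔭' h𝔭' hne ↦
    h W' N' K Dt' hb hs hN hK hH κ hκ γ 𝔭 h𝔭 he hf 𝔭' h𝔭' hne

/-- See `twinAlgMuZeroAtThree_of_withoutHeegner`. [folklore] -/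
theorem twinAlgMuZeroAtThree_of_strong (h : TwinAlgMuZeroAtThreeStrong) : TwinAlgMuZeroAtThree :=
  fun W' _ _ N' _ K _ _ Dt' hb hs hN hK hH ho κ hκ γ _ 𝔭 h𝔭 he hf 𝔭' h𝔭' _ ↦
    h W' N' K Dt' hb hs hN hK hH ho κ hκ γ 𝔭 h𝔭 he hf 𝔭' h𝔭'

/-! ## §3 Near-misses (sorry permitted ONLY here; obstruction in the docstring) -/

/-- NEAR-MISS — **Heegner is load-bearing for the torsion clause.** Expected witness: `E' = 15a1`
(`N' = 15`, bucket B: `Negative/Habitat.lean`), `K = ℚ(√−23)` (`d_K = −23` odd, `3` split, `5` INERT: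
Heegner fails, the pair `(E', K)` is DEFINITE with `N⁻ = 5`). Then every BDP-region twist
`L(f_{E'}, χ⁻¹, 0)` has sign `−1` and vanishes (Brooks 2015, pp. 2, 54; BDP 2013 §4.1), the
anticyclotomic line of the two-variable `(∅,0)` main conjecture degenerates, and `X_{∅,0}(E'/K_∞)` has
`Λ`-rank `1` (`≥ 1`: two-variable divisibility from Beilinson–Flach classes + control; `≤ 1`:
`Sel_{ord,ord}` cotorsion, Bertolini–Darmon), so `Module.IsTorsion Λ X` FAILS. OBSTRUCTION: neither
the definite-case `Λ`-rank theorem nor a `ModularParametrizationData (15a1) 15` term is constructible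
in the tree; tried: `lit` corpus + galaxy for a printed definite-case rank statement for the
relaxed/strict structure (Hatley–Lei 2019/2021 treat the indefinite case only), tree search for
`IsTorsion`-negations of `XAc` (none). If a `Literature` fact `H := "definite ⇒ ¬ IsTorsion X_{∅,0}"`
is filed, this becomes the Negative lemma `…_false_without_heegner_of_H` at once.
[cite: Brooks2015IMRN, p. 2 and p. 54] -/
theorem twinAlgMuZeroAtThree_false_without_heegner : ¬ TwinAlgMuZeroAtThreeWithoutHeegner := by
  sorry

end Summit.BirchSwinnertonDyer.BirchSwinnertonDyer.Cruxes.TwinAlgMuZeroAtThree.Disproof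

end
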